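import Literature.AnabelianGeometry.AbsoluteAnabelian.MonoidKummerMapsSub
import Literature.AnabelianGeometry.AbsoluteAnabelian.AutPairCenterFreeProofs

/-!
# [AbsTopIII] Prop 3.2 (iv) for `T = TF`: inner automorphisms lift, centre-freeness ⇐ injectivity + `Z(Π) = 1`,
# and `𝒞^{MLF-H}_TF` is id-rigid (proofs + the Def 3.1 (ii)↔(iii) dictionary for `TF`-pairs; abc-iut cell,
# sub-DAG [AbsTopIII] Prop 3.2 (i)(iv), rows P32.iv.L13a-TF / L14-TF / L17-TF)

S. Mochizuki, *Topics in Absolute Anabelian Geometry III*, §3, Prop. 3.2 (iv) p. 72 (proof p. 72 l.43–p. 73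
l.4), bib key `MochizukiAbsTopIII2015` (kurims manuscript, lit key `paper:url-5493eb38cbb7`), author's
Comments (2019) item (5) in force.  Prop. 3.2 has «`T ∈ {TM, TF}`»; the `TM` halves of these rows are
`MonoidKummerMapsIdRigidProofs.lean`; this file does the `TF` halves over abc-iut-L4-t2's `GaloisFieldPair` /
`MLFGaloisFieldPairCat` and the typed `TF` clauses of `MonoidKummerMapsSub.lean` (v2):

* the dictionary `GaloisFieldPair.isoOfCatIso` / `GaloisFieldPair.Iso.toHom` / `Iso.symm'` / `Iso.toCatIso`
  between isomorphisms of `TF`-pairs (Def 3.1 (ii)) and isomorphisms in the category `𝒞^MLF_TF` (Def 3.1 (iii));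
* **row L13a-TF** `GaloisFieldPair.Iso.conj` — for `g ∈ Π`, `(conj_g, x ↦ g • x)` is an automorphism of the
  pair `(Π ↷ k̄)` («contains the subgroup … determined by the inner automorphisms of `Π`», CONSTRUCTED);
* **row L14-TF** `autFieldPairCenterFree_of_center_eq_bot` / `…_of_isSlimGroup` — the printed deduction
  «In light of this injectivity, the center-free-ness … follows immediately from the slimness of `Π`»: `TF`
  injectivity (`FieldPairIsoDeterminedByGalois`, typed; its discharge via the intrinsic `𝒪^⊳` is a separate
  file) ∧ `Z(Π) = 1` ⇒ `AutFieldPairCenterFree H` (abc-iut-L6-t13's `TM` argument, verbatim for field pairs);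
* **row L17-TF** `prop32iv_idRigidTF_of_autFieldPairCenterFree` / `prop32iv_idRigidTF_of_isSlimGroup` — the
  full subcategory `𝒞^{MLF-H}_TF` is id-rigid (§0) once `Aut` is centre-free for every object satisfying `H`.

HONEST FRAMING: OUR kernel check of the printed deductions between statements of a refereed paper, modulo the
named inputs (slimness of `Π`; `TF` injectivity); nothing here bears on [IUTchIII] Cor. 3.12, and nothing here
asserts that abc is proved or refuted.
-/

namespace Literature.AnabelianGeometry.AbsoluteAnabelian

open _root_.CategoryTheory

universe u

noncomputable section

/-! ### Bridges for `TF`-pairs: Def 3.1 (ii) isomorphisms ↔ isomorphisms in `𝒞^MLF_TF` (Def 3.1 (iii)) -/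

namespace GaloisFieldPair

variable {P Q : GaloisFieldPair.{u}}

/-- Membership in the arithmetic kernel of a `TF`-pair: `g` acts trivially on the field.
[cite: MochizukiAbsTopIII2015, Definition 3.1 (ii) p.67] -/
theorem mem_actionKer_iff (P : GaloisFieldPair.{u}) (g : P.Pi) : g ∈ P.actionKer ↔ ∀ x : P.M, g • x = x := by
  simp only [GaloisFieldPair.actionKer, MonoidHom.mem_ker, RingEquiv.ext_iff, MulSemiringAction.toRingAut_apply,
    MulSemiringAction.toRingEquiv_apply_apply, RingAut.one_apply]

/-- An isomorphism in the category of `TF`-pairs (Def 3.1 (iii)) yields an isomorphism of `TF`-pairs in the sense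
of Def 3.1 (ii) (`GaloisFieldPair.Iso`). [cite: MochizukiAbsTopIII2015, Definition 3.1 (iii) p.67] -/
def isoOfCatIso (a : P ≅ Q) : GaloisFieldPair.Iso P Q where
  isoPi :=
    { toFun := a.hom.homPi
      invFun := a.inv.homPi
      left_inv := fun g => by
        have h := congrArg (fun φ : P.Hom P => φ.homPi g) a.hom_inv_id
        exact h
      right_inv := fun g => by
        have h := congrArg (fun φ : Q.Hom Q => φ.homPi g) a.inv_hom_id
        exact h
      map_mul' := fun g h => a.hom.homPi.map_mul g h
      continuous_toFun := a.hom.continuous_homPi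
      continuous_invFun := a.inv.continuous_homPi }
  isoM :=
    { toFun := a.hom.homM
      invFun := a.inv.homM
      left_inv := fun x => by
        have h := congrArg (fun φ : P.Hom P => φ.homM x) a.hom_inv_id
        exact h
      right_inv := fun x => by
        have h := congrArg (fun φ : Q.Hom Q => φ.homM x) a.inv_hom_id
        exact h
      map_mul' := fun x y => a.hom.homM.map_mul x y
      map_add' := fun x y => a.hom.homM.map_add x y }
  smul_comm g x := a.hom.smul_comm g x

/-- The Galois component of `isoOfCatIso a` is `a.hom.homPi`. [cite: MochizukiAbsTopIII2015, Definition 3.1 (iii) p.67] -/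
@[simp] theorem isoOfCatIso_isoPi_apply (a : P ≅ Q) (g : P.Pi) : (isoOfCatIso a).isoPi g = a.hom.homPi g := rfl
/-- The field component of `isoOfCatIso a` is `a.hom.homM`. [cite: MochizukiAbsTopIII2015, Definition 3.1 (iii) p.67] -/
@[simp] theorem isoOfCatIso_isoM_apply (a : P ≅ Q) (x : P.M) : (isoOfCatIso a).isoM x = a.hom.homM x := rfl

/-- Conversely an isomorphism of `TF`-pairs in the sense of Def 3.1 (ii) is a morphism of pairs (Def 3.1 (iii)).
[cite: MochizukiAbsTopIII2015, Definition 3.1 (iii) p.67] -/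
def Iso.toHom (e : GaloisFieldPair.Iso P Q) : P.Hom Q where
  homPi := e.isoPi.toMonoidHom
  continuous_homPi := e.isoPi.continuous
  homM := e.isoM.toRingHom
  smul_comm g x := e.smul_comm g x
  comap_ker := by
    ext g
    simp only [Subgroup.mem_comap, mem_actionKer_iff]
    constructor
    · intro h x
      have hx := h (e.isoM x)
      rw [show ((e.isoPi.toMonoidHom g) : Q.Pi) = e.isoPi g from rfl, ← e.smul_comm] at hx
      exact e.isoM.injective hx
    · intro h y
      obtain ⟨x, rfl⟩ := e.isoM.surjective y
      rw [show ((e.isoPi.toMonoidHom g) : Q.Pi) = e.isoPi g from rfl, ← e.smul_comm, h x]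
  isOpen_image U hU := by
    refine Subgroup.isOpen_mono le_sup_left ?_
    rw [Subgroup.coe_map]
    exact e.isoPi.isOpenMap _ hU

/-- The Galois component of `e.toHom` is `e.isoPi`. [cite: MochizukiAbsTopIII2015, Definition 3.1 (iii) p.67] -/
@[simp] theorem Iso.toHom_homPi_apply (e : GaloisFieldPair.Iso P Q) (g : P.Pi) : e.toHom.homPi g = e.isoPi g := rfl
/-- The field component of `e.toHom` is `e.isoM`. [cite: MochizukiAbsTopIII2015, Definition 3.1 (iii) p.67] -/
@[simp] theorem Iso.toHom_homM_apply (e : GaloisFieldPair.Iso P Q) (x : P.M) : e.toHom.homM x = e.isoM x := rfl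

/-- The inverse isomorphism of `TF`-pairs. [cite: MochizukiAbsTopIII2015, Definition 3.1 (ii) p.67] -/
def Iso.symm' (e : GaloisFieldPair.Iso P Q) : GaloisFieldPair.Iso Q P where
  isoPi := e.isoPi.symm
  isoM := e.isoM.symm
  smul_comm g y := by
    apply e.isoM.injective
    obtain ⟨x, rfl⟩ := e.isoM.surjective y
    obtain ⟨h, rfl⟩ := e.isoPi.surjective g
    simp [e.smul_comm]

/-- The identity isomorphism of a `TF`-pair. [cite: MochizukiAbsTopIII2015, Definition 3.1 (ii) p.67] -/
def Iso.refl' (P : GaloisFieldPair.{u}) : GaloisFieldPair.Iso P P where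
  isoPi := ContinuousMulEquiv.refl P.Pi
  isoM := RingEquiv.refl P.M
  smul_comm _ _ := rfl

/-- Composition of isomorphisms of `TF`-pairs. [cite: MochizukiAbsTopIII2015, Definition 3.1 (ii) p.67] -/
def Iso.trans' {R : GaloisFieldPair.{u}} (e : GaloisFieldPair.Iso P Q) (f : GaloisFieldPair.Iso Q R) :
    GaloisFieldPair.Iso P R where
  isoPi := e.isoPi.trans f.isoPi
  isoM := e.isoM.trans f.isoM
  smul_comm g x := by
    show f.isoM (e.isoM (g • x)) = f.isoPi (e.isoPi g) • f.isoM (e.isoM x)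
    rw [e.smul_comm, f.smul_comm]

/-- Components of a composite (bookkeeping). [cite: MochizukiAbsTopIII2015, Definition 3.1 (ii) p.67] -/
@[simp] theorem Iso.trans'_isoPi_apply {R : GaloisFieldPair.{u}} (e : GaloisFieldPair.Iso P Q)
    (f : GaloisFieldPair.Iso Q R) (g : P.Pi) : (e.trans' f).isoPi g = f.isoPi (e.isoPi g) := rfl

/-- Components of a composite (bookkeeping). [cite: MochizukiAbsTopIII2015, Definition 3.1 (ii) p.67] -/
@[simp] theorem Iso.trans'_isoM_apply {R : GaloisFieldPair.{u}} (e : GaloisFieldPair.Iso P Q)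
    (f : GaloisFieldPair.Iso Q R) (x : P.M) : (e.trans' f).isoM x = f.isoM (e.isoM x) := rfl

/-- Components of the inverse (bookkeeping). [cite: MochizukiAbsTopIII2015, Definition 3.1 (ii) p.67] -/
@[simp] theorem Iso.symm'_isoPi_apply (e : GaloisFieldPair.Iso P Q) (g : Q.Pi) : e.symm'.isoPi g = e.isoPi.symm g := rfl

/-- Components of the inverse (bookkeeping). [cite: MochizukiAbsTopIII2015, Definition 3.1 (ii) p.67] -/
@[simp] theorem Iso.symm'_isoM_apply (e : GaloisFieldPair.Iso P Q) (x : Q.M) : e.symm'.isoM x = e.isoM.symm x := rfl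

/-- The isomorphism in `𝒞^MLF_TF`'s ambient category determined by an isomorphism of `TF`-pairs.
[cite: MochizukiAbsTopIII2015, Definition 3.1 (iii) p.67] -/
def Iso.toCatIso (e : GaloisFieldPair.Iso P Q) : P ≅ Q where
  hom := e.toHom
  inv := e.symm'.toHom
  hom_inv_id := GaloisFieldPair.Hom.ext (MonoidHom.ext fun g => e.isoPi.symm_apply_apply g)
    (RingHom.ext fun x => e.isoM.symm_apply_apply x)
  inv_hom_id := GaloisFieldPair.Hom.ext (MonoidHom.ext fun g => e.isoPi.apply_symm_apply g)
    (RingHom.ext fun x => e.isoM.apply_symm_apply x)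

/-- **Row P32.iv.L13a for `T = TF`** (p. 72 l.23–25 «contains the subgroup of `Aut_{𝒯𝒢}(Π)` determined by the
inner automorphisms of `Π`»): conjugation by `g ∈ Π` on `Π` together with the ring automorphism `x ↦ g • x` of
`k̄` is an isomorphism of the `TF`-pair `(Π ↷ k̄)` with itself (CONSTRUCTED).
[cite: MochizukiAbsTopIII2015, Proposition 3.2 (iv) p.72] -/
def Iso.conj (P : GaloisFieldPair.{u}) (g : P.Pi) : GaloisFieldPair.Iso P P where
  isoPi :=
    { MulAut.conj g with
      continuous_toFun := (continuous_const.mul continuous_id).mul continuous_const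
      continuous_invFun := (continuous_const.mul continuous_id).mul continuous_const }
  isoM := MulSemiringAction.toRingEquiv P.Pi P.M g
  smul_comm h x := by
    show g • (h • x) = (g * h * g⁻¹) • g • x
    rw [mul_smul, mul_smul, inv_smul_smul]

/-- `Iso.conj P g` acts on `Π` by conjugation. [cite: MochizukiAbsTopIII2015, Proposition 3.2 (iv) p.72] -/
@[simp] theorem Iso.conj_isoPi_apply (P : GaloisFieldPair.{u}) (g h : P.Pi) :
    (Iso.conj P g).isoPi h = g * h * g⁻¹ := rfl

/-- `Iso.conj P g` acts on `k̄` by `g • ·`. [cite: MochizukiAbsTopIII2015, Proposition 3.2 (iv) p.72] -/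
@[simp] theorem Iso.conj_isoM_apply (P : GaloisFieldPair.{u}) (g : P.Pi) (x : P.M) :
    (Iso.conj P g).isoM x = g • x := rfl

end GaloisFieldPair

/-! ### Row P32.iv.L14 for `T = TF`: centre-freeness ⇐ injectivity + `Z(Π) = 1` -/

/-- **Row P32.iv.L14 for `T = TF`, hypothesis-explicit form** («In light of this injectivity, the
center-free-ness portion of assertion (iv) follows immediately from the slimness of `Π`», p. 72 l.47–49): if
isomorphisms of MLF-Galois `TF`-pairs are determined by their Galois components (`FieldPairIsoDeterminedByGalois`)
and `Π` has trivial centre for every `TF`-pair satisfying `H`, then `AutFieldPairCenterFree H` holds.  PROOF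
(abc-iut-L6-t13's `TM` argument): a central `e` commutes with the inner pair-automorphisms `Iso.conj P g`, so
`g⁻¹ · e_Π(g)` is central in `Π`, hence trivial; then `e_Π = id`, and `e_{k̄} = id` by injectivity.
[cite: MochizukiAbsTopIII2015, Proposition 3.2 (iv) p.72] -/
theorem autFieldPairCenterFree_of_center_eq_bot {H : GaloisFieldPair.{0} → Prop}
    (hinj : FieldPairIsoDeterminedByGalois)
    (hZ : ∀ P : GaloisFieldPair.{0}, IsMLFGaloisFieldPair P → H P → Subgroup.center P.Pi = ⊥) :
    AutFieldPairCenterFree H := by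
  intro P hP hH e _ hPi
  have hconj : ∀ g h : P.Pi, e.isoPi (g * h * g⁻¹) = g * e.isoPi h * g⁻¹ := fun g h =>
    hPi (GaloisFieldPair.Iso.conj P g) h
  have hid : ∀ g : P.Pi, e.isoPi g = g := by
    intro g
    have hz : g⁻¹ * e.isoPi g ∈ Subgroup.center P.Pi := by
      rw [Subgroup.mem_center_iff]
      intro y
      obtain ⟨h, rfl⟩ := e.isoPi.surjective y
      have hc := hconj g h
      rw [map_mul, map_mul, map_inv] at hc
      calc e.isoPi h * (g⁻¹ * e.isoPi g)
          = g⁻¹ * (g * e.isoPi h * g⁻¹) * e.isoPi g := by group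
        _ = g⁻¹ * (e.isoPi g * e.isoPi h * (e.isoPi g)⁻¹) * e.isoPi g := by rw [hc]
        _ = g⁻¹ * e.isoPi g * e.isoPi h := by group
    rw [hZ P hP hH, Subgroup.mem_bot, inv_mul_eq_one] at hz
    exact hz.symm
  have hePi : e.isoPi = (GaloisFieldPair.Iso.refl' P).isoPi := by
    ext g
    exact hid g
  have heM : e.isoM = (GaloisFieldPair.Iso.refl' P).isoM := hinj P P hP hP e _ hePi
  exact ⟨fun x => by rw [heM]; rfl, hid⟩

/-- **Row P32.iv.L14 for `T = TF`, modulo slimness**: with the tree's slimness predicate (`IsSlimGroup`: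
centralisers of open subgroups of `Π` are trivial, so `Z(Π) = 1`), `TF` injectivity ∧ slimness of `Π` ⇒
`AutFieldPairCenterFree H`. [cite: MochizukiAbsTopIII2015, Proposition 3.2 (iv) p.72] -/
theorem autFieldPairCenterFree_of_isSlimGroup {H : GaloisFieldPair.{0} → Prop}
    (hinj : FieldPairIsoDeterminedByGalois)
    (hslim : ∀ P : GaloisFieldPair.{0}, IsMLFGaloisFieldPair P → H P →
      Literature.AlgebraicGeometry.Frobenioids.IsSlimGroup P.Pi) :
    AutFieldPairCenterFree H := by
  refine autFieldPairCenterFree_of_center_eq_bot hinj fun P hP hH => ?_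
  have h := (hslim P hP hH).centralizer_eq_bot ⊤ isOpen_univ
  rw [← h]
  ext z
  simp [Subgroup.mem_center_iff, Subgroup.mem_centralizer_iff, eq_comm]

/-! ### Row P32.iv.L17 for `T = TF`: `𝒞^{MLF-H}_TF` is id-rigid -/

/-- **Row P32.iv.L17 for `T = TF`, modulo the centre-freeness schema**: if `Aut_{𝒞^MLF_TF}((Π ↷ k̄))` is
centre-free for every MLF-Galois `TF`-pair satisfying `H` (`AutFieldPairCenterFree H`), then the full subcategory
`𝒞^{MLF-H}_TF` is id-rigid («the categories … `𝒞^{MLF-hyp}_T`, `𝒞^{MLF-sB}_T` … are id-rigid [cf. §0]», p. 72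
l.26–28, at `T = TF`): the component of an automorphism of `𝟭` at an object commutes with every automorphism of
that object (`isIdRigid_of_aut_center_trivial`). [cite: MochizukiAbsTopIII2015, Proposition 3.2 (iv) p.72] -/
theorem prop32iv_idRigidTF_of_autFieldPairCenterFree {H : GaloisFieldPair.{0} → Prop}
    (hH : AutFieldPairCenterFree H) : Prop32iv_idRigidTF.{0} H := by
  refine isIdRigid_of_aut_center_trivial (MLFGaloisFieldPairSubcat.{0} H) fun X a ha => ?_
  obtain ⟨⟨P, hP⟩, hX⟩ := X
  let aP : GaloisFieldPair.Iso P P := GaloisFieldPair.isoOfCatIso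
    ((ObjectProperty.ι _).mapIso ((ObjectProperty.ι _).mapIso a))
  have hcomm : ∀ e' : GaloisFieldPair.Iso P P,
      (∀ x, aP.isoM (e'.isoM x) = e'.isoM (aP.isoM x)) ∧ ∀ g, aP.isoPi (e'.isoPi g) = e'.isoPi (aP.isoPi g) := by
    intro e'
    let b : (⟨⟨P, hP⟩, hX⟩ : MLFGaloisFieldPairSubcat.{0} H) ≅ ⟨⟨P, hP⟩, hX⟩ :=
      (ObjectProperty.fullyFaithfulι _).preimageIso ((ObjectProperty.fullyFaithfulι _).preimageIso e'.toCatIso)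
    have hab : (a.hom ≫ b.hom).hom.hom = (b.hom ≫ a.hom).hom.hom :=
      congrArg (fun φ => φ.hom.hom) (congrArg Iso.hom (ha b))
    have hM : ∀ x, e'.isoM (aP.isoM x) = aP.isoM (e'.isoM x) := fun x =>
      congrArg (fun φ : P.Hom P => φ.homM x) hab
    have hPi : ∀ g, e'.isoPi (aP.isoPi g) = aP.isoPi (e'.isoPi g) := fun g =>
      congrArg (fun φ : P.Hom P => φ.homPi g) hab
    exact ⟨fun x => (hM x).symm, fun g => (hPi g).symm⟩
  obtain ⟨hMid, hPiId⟩ := hH P hP hX aP (fun e' => (hcomm e').1) (fun e' => (hcomm e').2)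
  refine Iso.ext (ObjectProperty.hom_ext _ (ObjectProperty.hom_ext _
    (GaloisFieldPair.Hom.ext (MonoidHom.ext fun g => ?_) (RingHom.ext fun x => ?_))))
  · exact hPiId g
  · exact hMid x

/-- **Row P32.iv.L17 for `T = TF`, modulo slimness and `TF` injectivity** — the printed chain «injectivity …
centre-free … follows immediately from the slimness of `Π` … the categories … are id-rigid» at `T = TF`: if `H`
forces `Π` to be slim and isomorphisms of MLF-Galois `TF`-pairs are determined by their Galois components, then
`𝒞^{MLF-H}_TF` is id-rigid. [cite: MochizukiAbsTopIII2015, Proposition 3.2 (iv) p.72] -/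
theorem prop32iv_idRigidTF_of_isSlimGroup {H : GaloisFieldPair.{0} → Prop}
    (hinj : FieldPairIsoDeterminedByGalois)
    (hslim : ∀ P : GaloisFieldPair.{0}, IsMLFGaloisFieldPair P → H P →
      Literature.AlgebraicGeometry.Frobenioids.IsSlimGroup P.Pi) :
    Prop32iv_idRigidTF.{0} H :=
  prop32iv_idRigidTF_of_autFieldPairCenterFree (autFieldPairCenterFree_of_isSlimGroup hinj hslim)

end

end Literature.AnabelianGeometry.AbsoluteAnabelian
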